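/-
Copyright (c) 2026 the pub-hodgecm-mathlib formalisation cell (harness21).  Prover seat hodgecm-mathlib-K2Liu-p02 (g4), Track B «K2-LIT» ∕
hLiu418 #184♮, socket #42R `sig_K2LiuEisensteinResidueIsThetaIntegral`, organ (I4) «ORIGIN VALUES ARE MOVER-INDEPENDENT» (LEAD F0P6-plan (g11)
ruling «M-155k» (3), 2026-09-04).
-/
import Literature.NumberTheory.Weil1964.AdelicDoublingOriginValueInvariance   -- ★ `omega_adelicSiegelLiftCont_apply_zero`, `omega_ratThetaLiftCont_apply_zero_of_mem_siegelParabolicPi`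

/-!
# Crux `HLiu418`, road `K2_Liu`, socket #42R ∕ #42F ∕ #42N — organ (I4): the value at the origin is unchanged by Weil's lift of the Siegel
# parabolic, hence by any RATIONAL mover stabilising `𝕐`

Cell `hodgecm-mathlib`, crux item hLiu418 = `stmt-HodgeConjecture-24832`; squad K2 ∕ K2Liu, LEAD F0P6-plan (g11) «M-155k» (3), prover K2Liu-p02 (g4).
THEOREMS ONLY (no `def` ∕ instance ∕ notation ∕ named-fact hypothesis ∕ `sorry`, default heartbeats); lane `--supports stmt-HodgeConjecture-24832 --as helper`
(count-neutral).  GENERIC over a number field `F`, an index `Fin n` and an adelic Gram matrix `T` with `IsUnit T.det` (★ `AdelicSiegelParabolicLift`).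

WHY.  Siegel–Weil sections are origin values `(ω(r_F(γ) · s(h))Φ)(0)` read through a rational mover `γ` carrying the diagonal Lagrangian onto `𝕐`
(★ `swSection` uses `γ = δ` = ★ `deltaDiag`; #42F's Ikeda road uses the Cayley mover `κ`, M-155k (2)); two such movers differ by `p = κδ⁻¹ ∈ P_𝕐(F)`,
and the parabolic clauses of ★ `IsDoubledWeilRep` ∕ #42N are origin-scalar statements conjugated by elements of `𝐫₀(P_𝕐)`.  All of this rests on ONE
fact, [Weil1964, Chap. I n° 13 p. 160]: Weil's canonical lift `𝐫₀(p) = t₀(f) d₀(α)` of `p ∈ P_𝕐(𝔸)` acts by `(𝐫₀(p)Φ)(x) = ψ(½β(u,v)) Φ(u)`, `(u,v) = p⁻¹(x,0)`,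
so `(𝐫₀(p)Φ)(0) = Φ(0)` — in the tree ★ `adelicSiegelLift_mem_adelicMpZero`.  This file turns it into the consumer shapes:

* `omega_siegelLift_mul_apply_zero` ∕ `omega_siegelLift_inv_mul_apply_zero(')` — `(ω(𝐫₀ p · q)Φ)(0) = (ω(q)Φ)(0)` for EVERY `p ∈ P_𝕐(𝔸)` and every
  `q ∈ Mp_ψ(W_𝔸)ᶜᵒⁿᵗ` (over ★ `omega_adelicSiegelLiftCont_apply_zero` of ★ `AdelicDoublingOriginValueInvariance`, the E-2 engine's origin-invariance file);
* **`omega_conj_siegelLift_apply_zero_of_scalar`** — ORIGIN SCALARS SURVIVE CONJUGATION BY `𝐫₀(P_𝕐(𝔸))`: if `(ω(q)Ψ)(0) = c · Ψ(0)` for all `Ψ`, then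
  `(ω(𝐫₀ p · q · (𝐫₀ p)⁻¹)Φ)(0) = c · Φ(0)` for all `Φ` (the step «`T = 𝐫₀(u)·S·𝐫₀(u)⁻¹` has the origin scalar of `S`» of the #42N road, census addendum (N-c′));
* **`omega_ratThetaLiftCont_mul_apply_zero_of_mul_inv_mem`** — TWO RATIONAL MOVERS `γ₁, γ₂` with `ratSp(γ₂γ₁⁻¹) ∈ P_𝕐(𝔸)` give the SAME origin
  values `(ω(r_F γ₂ · q)Φ)(0) = (ω(r_F γ₁ · q)Φ)(0)` (over ★ `omega_ratThetaLiftCont_apply_zero_of_mem_siegelParabolicPi`), and the `ratSiegelParabolicPi`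
  form `omega_ratPointsThetaLiftCont_mul_apply_zero`.

NOT here: the transport of ★ `cayleyMover` into `Sp(𝕎^𝔻_𝔸)` and `κδ⁻¹ ∈ P_𝕐(F)` (#42F's words), the #42N assembly.
HONEST LABEL.  Count-neutral helper; it pays nothing by itself: `HC_CM` is proved only modulo the 7 printed citations (2 remaining named inputs:
hLiu418 = `stmt-HodgeConjecture-24832`, h413 = `stmt-HodgeConjecture-24833`) until rung 0 closes.
References: [Weil1964] Chap. I n° 13 p. 160, Chap. III n° 41 Thm 6, n° 46 (42); [Kudla1994] §3; [HarrisKudlaSweet1996] §1 (1.8), App. A; [GanQiuTakeda2014] §2.8.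
-/

set_option autoImplicit false
-- the mandated namespace repeats the single-problem summit's segment (`HodgeConjecture.HodgeConjecture`)
set_option linter.dupNamespace false

noncomputable section

open NumberField IsDedekindDomain
open scoped Classical
open Literature.NumberTheory.Automorphic Literature.NumberTheory.Weil1964
open Literature.RepresentationTheory.HeisenbergGroup

namespace Summit.HodgeConjecture.HodgeConjecture.Cruxes.HLiu418.K2LiuSiegelMoverOriginValue

variable {F : Type} [Field F] [NumberField F] {n : ℕ}
  {T : Matrix (Fin n) (Fin n) (AdeleRing (𝓞 F) F)} (hT : IsUnit T.det)

/-! ## §1 `𝐫₀(P_𝕐(𝔸))` fixes origin values -/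

/-- bookkeeping: `ω(x · y)Φ` at the origin equals `ω(x)(ω(y)Φ)` at the origin (explicit `map_mul`, no unification across the carriers).
[cite: Weil1964, Chap. I n° 13 p. 160] -/
theorem omega_mul_apply_zero (x y : adelicMpCont F (Fin n) T) (Φ : piSchwartzBruhat F (Fin n)) :
    ((adelicMpCont.omega F (Fin n) T (x * y) Φ : piSchwartzBruhat F (Fin n)) : (Fin n → AdeleRing (𝓞 F) F) → ℂ) 0 =
      ((adelicMpCont.omega F (Fin n) T x (adelicMpCont.omega F (Fin n) T y Φ) : piSchwartzBruhat F (Fin n)) :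
        (Fin n → AdeleRing (𝓞 F) F) → ℂ) 0 :=
  congrArg (fun M : Module.End ℂ (piSchwartzBruhat F (Fin n)) =>
      ((M Φ : piSchwartzBruhat F (Fin n)) : (Fin n → AdeleRing (𝓞 F) F) → ℂ) 0)
    (map_mul (adelicMpCont.omega F (Fin n) T) x y)

/-- **`(ω(𝐫₀ p · q)Φ)(0) = (ω(q)Φ)(0)`**: left multiplication by Weil's lift of the Siegel parabolic does not change origin values.
[cite: Weil1964, Chap. I n° 13 p. 160] -/
theorem omega_siegelLift_mul_apply_zero (p : siegelParabolicPi T) (q : adelicMpCont F (Fin n) T) (Φ : piSchwartzBruhat F (Fin n)) :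
    ((adelicMpCont.omega F (Fin n) T (adelicSiegelLiftCont F T hT p * q) Φ : piSchwartzBruhat F (Fin n)) :
        (Fin n → AdeleRing (𝓞 F) F) → ℂ) 0 =
      ((adelicMpCont.omega F (Fin n) T q Φ : piSchwartzBruhat F (Fin n)) : (Fin n → AdeleRing (𝓞 F) F) → ℂ) 0 :=
  (omega_mul_apply_zero _ _ Φ).trans (omega_adelicSiegelLiftCont_apply_zero F T hT p _)

/-- the same with the inverse lift `(𝐫₀ p)⁻¹ = 𝐫₀(p⁻¹)`. [cite: Weil1964, Chap. I n° 13 p. 160] -/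
theorem omega_siegelLift_inv_mul_apply_zero (p : siegelParabolicPi T) (q : adelicMpCont F (Fin n) T) (Φ : piSchwartzBruhat F (Fin n)) :
    ((adelicMpCont.omega F (Fin n) T ((adelicSiegelLiftCont F T hT p)⁻¹ * q) Φ : piSchwartzBruhat F (Fin n)) :
        (Fin n → AdeleRing (𝓞 F) F) → ℂ) 0 =
      ((adelicMpCont.omega F (Fin n) T q Φ : piSchwartzBruhat F (Fin n)) : (Fin n → AdeleRing (𝓞 F) F) → ℂ) 0 := by
  have e1 : (adelicSiegelLiftCont F T hT p)⁻¹ * q = adelicSiegelLiftCont F T hT p⁻¹ * q :=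
    congrArg (· * q) (map_inv (adelicSiegelLiftCont F T hT) p).symm
  exact (congrArg (fun z : adelicMpCont F (Fin n) T =>
      ((adelicMpCont.omega F (Fin n) T z Φ : piSchwartzBruhat F (Fin n)) : (Fin n → AdeleRing (𝓞 F) F) → ℂ) 0) e1).trans
    (omega_siegelLift_mul_apply_zero hT p⁻¹ q Φ)

/-- `(ω((𝐫₀ p)⁻¹)Φ)(0) = Φ(0)`. [cite: Weil1964, Chap. I n° 13 p. 160] -/
theorem omega_siegelLift_inv_mul_apply_zero' (p : siegelParabolicPi T) (Φ : piSchwartzBruhat F (Fin n)) :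
    ((adelicMpCont.omega F (Fin n) T (adelicSiegelLiftCont F T hT p)⁻¹ Φ : piSchwartzBruhat F (Fin n)) :
        (Fin n → AdeleRing (𝓞 F) F) → ℂ) 0 =
      (Φ : (Fin n → AdeleRing (𝓞 F) F) → ℂ) 0 :=
  (congrArg (fun z : adelicMpCont F (Fin n) T =>
      ((adelicMpCont.omega F (Fin n) T z Φ : piSchwartzBruhat F (Fin n)) : (Fin n → AdeleRing (𝓞 F) F) → ℂ) 0)
    (map_inv (adelicSiegelLiftCont F T hT) p).symm).trans (omega_adelicSiegelLiftCont_apply_zero F T hT p⁻¹ Φ)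

/-- **ORIGIN SCALARS SURVIVE CONJUGATION BY `𝐫₀(P_𝕐(𝔸))`**: if `ω(q)` has origin scalar `c` (`(ω(q)Ψ)(0) = c · Ψ(0)` for all `Ψ`), then so has
`ω(𝐫₀ p · q · (𝐫₀ p)⁻¹)` — the step (N-c′) of the #42N road («`T = 𝐫₀(u)·S·𝐫₀(u)⁻¹` has the origin scalar of `S`»).
[cite: Weil1964, Chap. I n° 13 p. 160] [cite: HarrisKudlaSweet1996, App. A Lem. A.2] -/
theorem omega_conj_siegelLift_apply_zero_of_scalar (p : siegelParabolicPi T) (q : adelicMpCont F (Fin n) T) (c : ℂ)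
    (hq : ∀ Ψ : piSchwartzBruhat F (Fin n),
      ((adelicMpCont.omega F (Fin n) T q Ψ : piSchwartzBruhat F (Fin n)) : (Fin n → AdeleRing (𝓞 F) F) → ℂ) 0 =
        c * (Ψ : (Fin n → AdeleRing (𝓞 F) F) → ℂ) 0)
    (Φ : piSchwartzBruhat F (Fin n)) :
    ((adelicMpCont.omega F (Fin n) T (adelicSiegelLiftCont F T hT p * q * (adelicSiegelLiftCont F T hT p)⁻¹) Φ :
        piSchwartzBruhat F (Fin n)) : (Fin n → AdeleRing (𝓞 F) F) → ℂ) 0 =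
      c * (Φ : (Fin n → AdeleRing (𝓞 F) F) → ℂ) 0 := by
  have e1 : adelicSiegelLiftCont F T hT p * q * (adelicSiegelLiftCont F T hT p)⁻¹ =
      adelicSiegelLiftCont F T hT p * (q * (adelicSiegelLiftCont F T hT p)⁻¹) := mul_assoc _ _ _
  refine (congrArg (fun z : adelicMpCont F (Fin n) T =>
      ((adelicMpCont.omega F (Fin n) T z Φ : piSchwartzBruhat F (Fin n)) : (Fin n → AdeleRing (𝓞 F) F) → ℂ) 0) e1).trans ?_
  refine (omega_siegelLift_mul_apply_zero hT p _ Φ).trans ?_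
  refine (omega_mul_apply_zero q _ Φ).trans ?_
  refine (hq _).trans ?_
  exact congrArg (fun t : ℂ => c * t) (omega_siegelLift_inv_mul_apply_zero' hT p Φ)

/-- conjugating BACK: if `ω(𝐫₀ p · q · (𝐫₀ p)⁻¹)` has origin scalar `c`, so has `ω(q)`. [cite: Weil1964, Chap. I n° 13 p. 160] -/
theorem omega_apply_zero_of_conj_siegelLift_scalar (p : siegelParabolicPi T) (q : adelicMpCont F (Fin n) T) (c : ℂ)
    (hq : ∀ Ψ : piSchwartzBruhat F (Fin n),
      ((adelicMpCont.omega F (Fin n) T (adelicSiegelLiftCont F T hT p * q * (adelicSiegelLiftCont F T hT p)⁻¹) Ψ :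
          piSchwartzBruhat F (Fin n)) : (Fin n → AdeleRing (𝓞 F) F) → ℂ) 0 =
        c * (Ψ : (Fin n → AdeleRing (𝓞 F) F) → ℂ) 0)
    (Φ : piSchwartzBruhat F (Fin n)) :
    ((adelicMpCont.omega F (Fin n) T q Φ : piSchwartzBruhat F (Fin n)) : (Fin n → AdeleRing (𝓞 F) F) → ℂ) 0 =
      c * (Φ : (Fin n → AdeleRing (𝓞 F) F) → ℂ) 0 := by
  -- `q = L⁻¹ · ((L q L⁻¹) · L)` in any group, read at the origin
  have key : ∀ {G : Type _} [Group G] (L r : G), L⁻¹ * (L * r * L⁻¹ * L) = r := by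
    intro G _ L r; group
  refine (congrArg (fun z : adelicMpCont F (Fin n) T =>
      ((adelicMpCont.omega F (Fin n) T z Φ : piSchwartzBruhat F (Fin n)) : (Fin n → AdeleRing (𝓞 F) F) → ℂ) 0)
    (key (adelicSiegelLiftCont F T hT p) q).symm).trans ?_
  refine (omega_siegelLift_inv_mul_apply_zero hT p _ Φ).trans ?_
  refine (omega_mul_apply_zero _ _ Φ).trans ?_
  refine (hq _).trans ?_
  exact congrArg (fun t : ℂ => c * t) (omega_adelicSiegelLiftCont_apply_zero F T hT p Φ)

/-! ## §2 Rational movers: two movers differing by the stabiliser of `𝕐` give the same origin values -/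

/-- **`(ω(r_F(γ) · q)Φ)(0) = (ω(q)Φ)(0)` for a rational symplectic `γ` with `ratSp γ ∈ P_𝕐(𝔸)`** (★
`omega_ratThetaLiftCont_apply_zero_of_mem_siegelParabolicPi`: `r_F γ = 𝐫₀(ratSp γ)` by `Θ`-rigidity).
[cite: Weil1964, Chap. III n° 41 Thm 6 p. 193] [cite: Weil1964, Chap. I n° 13 p. 160] -/
theorem omega_ratThetaLiftCont_mul_apply_zero_of_mem (γ : Matrix.symplecticGroup (Fin n) F) (hγ : ratSp F T hT γ ∈ siegelParabolicPi T)
    (q : adelicMpCont F (Fin n) T) (Φ : piSchwartzBruhat F (Fin n)) :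
    ((adelicMpCont.omega F (Fin n) T (ratThetaLiftCont F T hT γ * q) Φ : piSchwartzBruhat F (Fin n)) :
        (Fin n → AdeleRing (𝓞 F) F) → ℂ) 0 =
      ((adelicMpCont.omega F (Fin n) T q Φ : piSchwartzBruhat F (Fin n)) : (Fin n → AdeleRing (𝓞 F) F) → ℂ) 0 :=
  (omega_mul_apply_zero _ _ Φ).trans (omega_ratThetaLiftCont_apply_zero_of_mem_siegelParabolicPi F T hT γ hγ _)

/-- **TWO RATIONAL MOVERS DIFFERING BY THE STABILISER OF `𝕐` GIVE THE SAME ORIGIN VALUES**: for rational symplectic `γ₁, γ₂` with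
`ratSp (γ₂ γ₁⁻¹) ∈ P_𝕐(𝔸)` and every `q ∈ Mp_ψ(W_𝔸)ᶜᵒⁿᵗ`, `(ω(r_F γ₂ · q)Φ)(0) = (ω(r_F γ₁ · q)Φ)(0)` — with `q = s(h)` a splitting value: the
Siegel–Weil sections read through `γ₁` (★ `swSection`'s `δ`, `δ W^Δ = 𝕐`) and through `γ₂` (the Cayley mover `κ`, `κ W^Δ = 𝕐`, M-155k (2)) COINCIDE,
since `κδ⁻¹` stabilises `𝕐`. [cite: Weil1964, Chap. III n° 41 Thm 6 p. 193] [cite: KudlaRallis1994, §1] [cite: HarrisKudlaSweet1996, §1 (1.8)] -/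
theorem omega_ratThetaLiftCont_mul_apply_zero_of_mul_inv_mem (γ₁ γ₂ : Matrix.symplecticGroup (Fin n) F)
    (h : ratSp F T hT (γ₂ * γ₁⁻¹) ∈ siegelParabolicPi T) (q : adelicMpCont F (Fin n) T) (Φ : piSchwartzBruhat F (Fin n)) :
    ((adelicMpCont.omega F (Fin n) T (ratThetaLiftCont F T hT γ₂ * q) Φ : piSchwartzBruhat F (Fin n)) :
        (Fin n → AdeleRing (𝓞 F) F) → ℂ) 0 =
      ((adelicMpCont.omega F (Fin n) T (ratThetaLiftCont F T hT γ₁ * q) Φ : piSchwartzBruhat F (Fin n)) :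
        (Fin n → AdeleRing (𝓞 F) F) → ℂ) 0 := by
  -- `r_F γ₂ · q = r_F(γ₂γ₁⁻¹) · (r_F γ₁ · q)` in `Mp_ψ(W_𝔸)ᶜᵒⁿᵗ`
  have e1 : ratThetaLiftCont F T hT γ₂ * q =
      ratThetaLiftCont F T hT (γ₂ * γ₁⁻¹) * (ratThetaLiftCont F T hT γ₁ * q) :=
    ((congrArg (fun g : Matrix.symplecticGroup (Fin n) F => ratThetaLiftCont F T hT g * q) (inv_mul_cancel_right γ₂ γ₁).symm).trans
      (congrArg (· * q) (map_mul (ratThetaLiftCont F T hT) (γ₂ * γ₁⁻¹) γ₁))).trans (mul_assoc _ _ _)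
  exact (congrArg (fun z : adelicMpCont F (Fin n) T =>
      ((adelicMpCont.omega F (Fin n) T z Φ : piSchwartzBruhat F (Fin n)) : (Fin n → AdeleRing (𝓞 F) F) → ℂ) 0) e1).trans
    (omega_ratThetaLiftCont_mul_apply_zero_of_mem hT (γ₂ * γ₁⁻¹) h _ Φ)

/-- the same phrased with a rational `p ∈ P_𝕐(F)` of ★ `ratSiegelParabolicPi` (generated by rational Levi and unipotent elements):
`(ω(r_F(p) · q)Φ)(0) = (ω(q)Φ)(0)` (★ `adelicSiegelLiftCont_eq_ratPointsThetaLiftCont`). [cite: Weil1964, Chap. III n° 41 Thm 6 p. 193] -/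
theorem omega_ratPointsThetaLiftCont_mul_apply_zero {p : siegelParabolicPi T} (hp : p ∈ ratSiegelParabolicPi F T hT)
    (q : adelicMpCont F (Fin n) T) (Φ : piSchwartzBruhat F (Fin n)) :
    ((adelicMpCont.omega F (Fin n) T
        (ratPointsThetaLiftCont F (Fin n) T hT ⟨(p : symplecticGroup (polar (adelicForm F (Fin n) T))), coe_mem_range_ratSp F T hT hp⟩ * q) Φ :
          piSchwartzBruhat F (Fin n)) : (Fin n → AdeleRing (𝓞 F) F) → ℂ) 0 =
      ((adelicMpCont.omega F (Fin n) T q Φ : piSchwartzBruhat F (Fin n)) : (Fin n → AdeleRing (𝓞 F) F) → ℂ) 0 :=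
  (congrArg (fun z : adelicMpCont F (Fin n) T =>
      ((adelicMpCont.omega F (Fin n) T (z * q) Φ : piSchwartzBruhat F (Fin n)) : (Fin n → AdeleRing (𝓞 F) F) → ℂ) 0)
    (adelicSiegelLiftCont_eq_ratPointsThetaLiftCont F T hT hp)).symm.trans (omega_siegelLift_mul_apply_zero hT p q Φ)

end Summit.HodgeConjecture.HodgeConjecture.Cruxes.HLiu418.K2LiuSiegelMoverOriginValue

end
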